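import Literature.AlgebraicGeometry.Frobenioids.PerfectionCategory
import Literature.AlgebraicGeometry.Frobenioids.MonoidFunctors
import Literature.AlgebraicGeometry.Frobenioids.PreFrobenioidDataOfFunctor
import Literature.AlgebraicGeometry.Frobenioids.BaseCategoryTheoreticityDefs
import HarnessLib

/-!
# Frobenioids I, Def. 3.1 (iii) / Prop. 3.2 (i): the pre-Frobenioid structure `C^pf → F_{Φ^pf}` of the
# perfection, and the `PerfectionData` of a Frobenioid

Mochizuki, *The geometry of Frobenioids I: the general theory*, Kyushu J. Math. **62** (2008)
293–400, Definition 3.1 (iii) p. 57 and Proposition 3.2 (i) p. 58 [cite: MochizukiFrdI2008, Prop. 3.2 (i) p.58]: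
"the Frobenioid `C` … determin[es] a natural functor `C^pf → F_{Φ^pf}`", 1-compatible with `C → F_Φ`.

Continuing `PerfectionCategory.lean`, this file equips `C^pf = Perfection hF` with its operations over
the base `D` — the data the rest of §3 consumes through t3's interface `PreFrobenioidData`:
* `Base(A, n) := Base(A)`; `Base` of a perfected morphism represented by `φ′ : A^{(a)} → B^{(b)}` is
  `Base(frob_A) ≫ Base(φ′) ≫ Base(frob_B)⁻¹` (Frobenius-type arrows are base-isomorphisms) —
  `Perfection.baseFunctor`;
* `deg_Fr[φ′] := deg_Fr(φ′)` (invariant under the transition maps: Prop. 1.10 (i));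
* `Div[φ′] := (frob_A)^* Div(φ′)` "divided by `n·a`", i.e. the class `(frob_A^* Div φ′)^{1/(n·a)}` in the
  monoid perfection `Φ(Base A)^pf` of found's `Monoids.lean` (invariant: along a transition of degree `t`
  the divisor is multiplied by `t`, Prop. 1.10 (i), and `(xᵗ)^{1/(Nt)} = x^{1/N}`); the level-free
  normalisation `n·a = m·b` is forced by Remark 1.1.1 for composites;
and proves the laws of Remark 1.1.1 for them (`Perfection.ops : PreFrobenioidData (Perfection hF) D`).
Finally `PreFrobenioidData.perfection` packages `(C^pf, C → C^pf, root, ops)` as a `PerfectionData`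
(file `BaseCategoryTheoreticityDefs.lean`, seat abc-iut-L1-t3).  NOTE (recorded, no claim): t3's
`PerfectionData S` does not constrain its fields by `S`; the honest link "this IS the perfection of the
Frobenioid `F`" is the definition itself (and t3's forthcoming predicate `PerfectionData.IsThePerfection`).

DISCLOSURE (hypothesis dropped, a proved generalisation).  Print constructs `C^pf` under the STANDING HYPOTHESIS
"Suppose that the Frobenioid `C` is of Frobenius-isotropic type" (Def. 3.1 (iii) p. 56, restated in the
preamble of Prop. 3.2, p. 58); this chain (`PerfectionFrobPow`, `Perfection`, `PerfectionCategory`,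
`PerfectionOps`, `PerfectionProofs`, `PerfectionCoAngular`) works over a bare Frobenioid `hF : IsFrobenioid F`
— the construction and Prop. 3.2 (i)(ii) need nothing more, so the printed instances follow a fortiori; the
hypothesis is used (and assumed) only where print needs it, for the isotropic-type clause of Prop. 3.2 (iii)
(`PerfectionIsotropic.lean`).
-/

namespace Literature.AlgebraicGeometry.Frobenioids

namespace PreFrobenioid

open CategoryTheory Opposite

universe w v v' u u'

variable {D : Type u} [Category.{v} D] {Φ : Dᵒᵖ ⥤ CommMonCat.{w}}
  {C : Type u'} [Category.{v'} C] {F : C ⥤ ElemFrobenioid Φ} (hF : IsFrobenioid F)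

/-! ### `Base` of the chosen Frobenius arrows -/

/-- `Base(frob)` is an isomorphism (Frobenius-type arrows are base-isomorphisms).
[cite: MochizukiFrdI2008, Def. 1.2 (iii) p.22] -/
theorem isIso_base_frob (A : C) (d : ℕ+) : IsIso (Base F (frob hF A d)) := (isFrobeniusType_frob hF A d).2

/-- The inverse `Base(A^{(d)}) → Base(A)` of `Base(frob)`. [cite: MochizukiFrdI2008, Def. 3.1 (iii) p.57] -/
noncomputable def baseInvFrob (A : C) (d : ℕ+) : baseObj F (frobPow hF A d) ⟶ baseObj F A :=
  inv (Base F (frob hF A d)) (I := isIso_base_frob hF A d)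

/-- `Base(frob) ≫ Base(frob)⁻¹ = id`. [cite: MochizukiFrdI2008, Def. 3.1 (iii) p.57] -/
@[reassoc (attr := simp)] theorem base_frob_baseInvFrob (A : C) (d : ℕ+) :
    Base F (frob hF A d) ≫ baseInvFrob hF A d = 𝟙 _ := by
  haveI := isIso_base_frob hF A d
  exact IsIso.hom_inv_id _

/-- `Base(frob)⁻¹ ≫ Base(frob) = id`. [cite: MochizukiFrdI2008, Def. 3.1 (iii) p.57] -/
@[reassoc (attr := simp)] theorem baseInvFrob_base_frob (A : C) (d : ℕ+) :
    baseInvFrob hF A d ≫ Base F (frob hF A d) = 𝟙 _ := by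
  haveI := isIso_base_frob hF A d
  exact IsIso.inv_hom_id _

/-- `Base` of a transition morphism, in terms of the chosen Frobenius arrows.
[cite: MochizukiFrdI2008, Def. 3.1 (ii) p.56] -/
theorem base_frobTrans (A : C) {d d' : ℕ+} (h : d ∣ d') :
    Base F (frobTrans hF A h) = baseInvFrob hF A d ≫ Base F (frob hF A d') := by
  rw [← frob_frobTrans hF A h, base_comp, ← Category.assoc, baseInvFrob_base_frob, Category.id_comp]

namespace Perfection

variable {hF} {X Y Z : Perfection hF}

/-! ### `Base`, `deg_Fr`, `Div` of representatives, and their invariance under transport -/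

/-- `Base` of a representative `φ′ : A^{(a)} → B^{(b)}`: `Base(frob_A) ≫ Base(φ′) ≫ Base(frob_B)⁻¹`.
[cite: MochizukiFrdI2008, Prop. 3.2 (i) p.58] -/
noncomputable def Rep.baseMap (r : Rep X Y) : baseObj F X.obj ⟶ baseObj F Y.obj :=
  Base F (frob hF X.obj r.L.a) ≫ Base F r.hom ≫ baseInvFrob hF Y.obj r.L.b

/-- `deg_Fr` of a representative. [cite: MochizukiFrdI2008, Prop. 3.2 (i) p.58] -/
noncomputable def Rep.degFr (r : Rep X Y) : ℕ+ := PreFrobenioid.degFr F r.hom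

/-- The perfected divisor of a representative at level `(a, b)`: the class of
`((frob_A)^* Div(φ′), n·a)` in `Φ(Base A)^pf`. [cite: MochizukiFrdI2008, Prop. 3.2 (i) p.58] -/
noncomputable def Rep.div (r : Rep X Y) : Frobenioids.Perfection (Φ.obj (op (baseObj F X.obj))) :=
  Frobenioids.Perfection.mk (pull Φ (Base F (frob hF X.obj r.L.a)) (Div F r.hom)) (X.idx * r.L.a)

/-- `Base` is unchanged by transport. [cite: MochizukiFrdI2008, Prop. 1.10 (i) p.34] -/
theorem baseMap_lift (L L' : Level X Y) (h : L.LE L') (φ : L.HomAt) :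
    Rep.baseMap ⟨L', Level.lift L L' h φ⟩ = Rep.baseMap ⟨L, φ⟩ := by
  unfold Rep.baseMap
  have sq := congrArg (Base F) (Level.lift_spec L L' h φ)
  rw [base_comp, base_comp, base_frobTrans, base_frobTrans] at sq
  change Base F (frob hF X.obj L'.a) ≫ Base F (Level.lift L L' h φ) ≫ baseInvFrob hF Y.obj L'.b =
    Base F (frob hF X.obj L.a) ≫ Base F φ ≫ baseInvFrob hF Y.obj L.b
  have e : Base F (frob hF X.obj L'.a) ≫ Base F (Level.lift L L' h φ) =
      Base F (frob hF X.obj L.a) ≫ Base F φ ≫ baseInvFrob hF Y.obj L.b ≫ Base F (frob hF Y.obj L'.b) := by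
    have := congrArg (fun k => Base F (frob hF X.obj L.a) ≫ k) sq
    simpa only [← Category.assoc, base_frob_baseInvFrob, Category.id_comp] using this
  rw [← Category.assoc, e, Category.assoc, Category.assoc, Category.assoc, base_frob_baseInvFrob,
    Category.comp_id]

/-- `deg_Fr` is unchanged by transport (Prop. 1.10 (i): `deg_Fr(φ) = deg_Fr(φ′)`).
[cite: MochizukiFrdI2008, Prop. 1.10 (i) p.34] -/
theorem degFr_lift (L L' : Level X Y) (h : L.LE L') (φ : L.HomAt) :
    Rep.degFr ⟨L', Level.lift L L' h φ⟩ = Rep.degFr ⟨L, φ⟩ :=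
  degFr_frobeniusConjugate (Level.lift_spec L L' h φ) (Level.degFr_eq L L' h)

/-- The perfected divisor is unchanged by transport (Prop. 1.10 (i): `Div(φ′) = t · α_* Div(φ)`, and
`(xᵗ)^{1/(n·a·t)} = x^{1/(n·a)}`). [cite: MochizukiFrdI2008, Prop. 1.10 (i) p.34] -/
theorem div_lift (L L' : Level X Y) (h : L.LE L') (φ : L.HomAt) :
    Rep.div ⟨L', Level.lift L L' h φ⟩ = Rep.div ⟨L, φ⟩ := by
  obtain ⟨t, ht⟩ := h.1
  have hα := isFrobeniusType_frobTrans hF X.obj h.1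
  have hβ := isFrobeniusType_frobTrans hF Y.obj h.2
  haveI : IsIso (Base F (frobTrans hF X.obj h.1)) := hα.2
  have hdiv := div_frobeniusConjugate (Level.lift_spec L L' h φ) hα hβ
  -- the degree of the transition is `t`
  have hdeg : (PreFrobenioid.degFr F (frobTrans hF Y.obj h.2) : ℕ) = t := by
    rw [← Level.degFr_eq L L' h]
    exact congrArg PNat.val (mul_left_cancel ((degFr_frobTrans hF X.obj h.1).trans ht))
  have hidx : X.idx * L'.a = X.idx * L.a * t := by rw [ht, mul_assoc]
  unfold Rep.div
  change Frobenioids.Perfection.mk (pull Φ (Base F (frob hF X.obj L'.a)) (Div F (Level.lift L L' h φ)))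
      (X.idx * L'.a) = Frobenioids.Perfection.mk (pull Φ (Base F (frob hF X.obj L.a)) (Div F φ)) (X.idx * L.a)
  rw [hdiv, hdeg, map_pow, hidx, ← frob_frobTrans hF X.obj h.1, base_comp, ← pull_comp, Category.assoc,
    IsIso.hom_inv_id, Category.comp_id, Frobenioids.Perfection.mk_pow_mul]

/-- Representatives of the same perfected morphism have the same `Base`.
[cite: MochizukiFrdI2008, Prop. 3.2 (i) p.58] -/
theorem baseMap_sound {r s : Rep X Y} (h : Agree r s) : r.baseMap = s.baseMap := by
  obtain ⟨M, hr, hs, e⟩ := h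
  rw [← baseMap_lift r.L M hr r.hom, ← baseMap_lift s.L M hs s.hom, e]

/-- Representatives of the same perfected morphism have the same `deg_Fr`.
[cite: MochizukiFrdI2008, Prop. 3.2 (i) p.58] -/
theorem degFr_sound {r s : Rep X Y} (h : Agree r s) : r.degFr = s.degFr := by
  obtain ⟨M, hr, hs, e⟩ := h
  rw [← degFr_lift r.L M hr r.hom, ← degFr_lift s.L M hs s.hom, e]

/-- Representatives of the same perfected morphism have the same perfected divisor.
[cite: MochizukiFrdI2008, Prop. 3.2 (i) p.58] -/
theorem div_sound {r s : Rep X Y} (h : Agree r s) : r.div = s.div := by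
  obtain ⟨M, hr, hs, e⟩ := h
  rw [← div_lift r.L M hr r.hom, ← div_lift s.L M hs s.hom, e]

/-- `Base` of a perfected morphism. [cite: MochizukiFrdI2008, Prop. 3.2 (i) p.58] -/
noncomputable def Hom.baseMap : (X ⟶ Y) → (baseObj F X.obj ⟶ baseObj F Y.obj) :=
  Quotient.lift Rep.baseMap fun _ _ h => baseMap_sound h

/-- `deg_Fr` of a perfected morphism. [cite: MochizukiFrdI2008, Prop. 3.2 (i) p.58] -/
noncomputable def Hom.degFr : (X ⟶ Y) → ℕ+ := Quotient.lift Rep.degFr fun _ _ h => degFr_sound h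

/-- The perfected divisor of a perfected morphism. [cite: MochizukiFrdI2008, Prop. 3.2 (i) p.58] -/
noncomputable def Hom.div : (X ⟶ Y) → Frobenioids.Perfection (Φ.obj (op (baseObj F X.obj))) :=
  Quotient.lift Rep.div fun _ _ h => div_sound h

/-- `Base` on classes. [cite: MochizukiFrdI2008, Prop. 3.2 (i) p.58] -/
@[simp] theorem baseMap_mk (r : Rep X Y) : Hom.baseMap (Hom.mk r) = r.baseMap := rfl

/-- `deg_Fr` on classes. [cite: MochizukiFrdI2008, Prop. 3.2 (i) p.58] -/
@[simp] theorem degFr_mk (r : Rep X Y) : Hom.degFr (Hom.mk r) = r.degFr := rfl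

/-- `Div` on classes. [cite: MochizukiFrdI2008, Prop. 3.2 (i) p.58] -/
@[simp] theorem div_mk (r : Rep X Y) : Hom.div (Hom.mk r) = r.div := rfl

/-! ### Remark 1.1.1 for the perfection -/

/-- `Base(id) = id`. [cite: MochizukiFrdI2008, Rem. 1.1.1 p.21] -/
theorem baseMap_id (X : Perfection hF) : Hom.baseMap (𝟙 X) = 𝟙 _ := by
  rw [id_eq_mk, baseMap_mk]
  change Base F (frob hF X.obj 1) ≫ Base F (𝟙 _) ≫ baseInvFrob hF X.obj 1 = 𝟙 _
  rw [base_id, Category.id_comp, base_frob_baseInvFrob]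

/-- `Base(g ∘ f) = Base(g) ∘ Base(f)`. [cite: MochizukiFrdI2008, Rem. 1.1.1 p.21] -/
theorem baseMap_comp (f : X ⟶ Y) (g : Y ⟶ Z) :
    Hom.baseMap (f ≫ g) = Hom.baseMap f ≫ Hom.baseMap g := by
  obtain ⟨r, rfl⟩ := Hom.mk_surjective f
  obtain ⟨s, rfl⟩ := Hom.mk_surjective g
  rw [mk_comp_mk, baseMap_mk, baseMap_mk, baseMap_mk,
    ← baseMap_lift r.L _ (Level₃.le_can_fst r s) r.hom, ← baseMap_lift s.L _ (Level₃.le_can_snd r s) s.hom]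
  change Base F (frob hF X.obj _) ≫ Base F (_ ≫ _) ≫ baseInvFrob hF Z.obj _ =
    (Base F (frob hF X.obj _) ≫ Base F _ ≫ baseInvFrob hF Y.obj _) ≫
      (Base F (frob hF Y.obj _) ≫ Base F _ ≫ baseInvFrob hF Z.obj _)
  simp only [base_comp, Category.assoc, baseInvFrob_base_frob_assoc]

/-- `deg_Fr(id) = 1`. [cite: MochizukiFrdI2008, Rem. 1.1.1 p.21] -/
theorem degFr_id' (X : Perfection hF) : Hom.degFr (𝟙 X) = 1 := by
  rw [id_eq_mk, degFr_mk]
  exact PreFrobenioid.degFr_id F _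

/-- `deg_Fr(g ∘ f) = deg_Fr(f) · deg_Fr(g)`. [cite: MochizukiFrdI2008, Rem. 1.1.1 p.21] -/
theorem degFr_comp' (f : X ⟶ Y) (g : Y ⟶ Z) :
    Hom.degFr (f ≫ g) = Hom.degFr f * Hom.degFr g := by
  obtain ⟨r, rfl⟩ := Hom.mk_surjective f
  obtain ⟨s, rfl⟩ := Hom.mk_surjective g
  rw [mk_comp_mk, degFr_mk, degFr_mk, degFr_mk,
    ← degFr_lift r.L _ (Level₃.le_can_fst r s) r.hom, ← degFr_lift s.L _ (Level₃.le_can_snd r s) s.hom]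
  exact PreFrobenioid.degFr_comp F _ _

/-- `Div(id) = 0`. [cite: MochizukiFrdI2008, Rem. 1.1.1 p.21] -/
theorem div_id' (X : Perfection hF) : Hom.div (𝟙 X) = 1 := by
  rw [id_eq_mk, div_mk]
  change Frobenioids.Perfection.mk (pull Φ _ (Div F (𝟙 _))) _ = 1
  rw [PreFrobenioid.div_id, map_one, Frobenioids.Perfection.mk_one]

/-- Remark 1.1.1 for perfected divisors: `Div(g ∘ f) = Base(f)^* Div(g) + deg_Fr(g) · Div(f)` in
`Φ^pf`. [cite: MochizukiFrdI2008, Rem. 1.1.1 p.21] -/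
theorem div_comp' (f : X ⟶ Y) (g : Y ⟶ Z) :
    Hom.div (f ≫ g) =
      Frobenioids.Perfection.map (pull Φ (Hom.baseMap f)) (Hom.div g) * Hom.div f ^ (Hom.degFr g : ℕ) := by
  obtain ⟨r, rfl⟩ := Hom.mk_surjective f
  obtain ⟨s, rfl⟩ := Hom.mk_surjective g
  rw [mk_comp_mk, div_mk, div_mk, div_mk, baseMap_mk, degFr_mk,
    ← div_lift r.L _ (Level₃.le_can_fst r s) r.hom, ← div_lift s.L _ (Level₃.le_can_snd r s) s.hom,
    ← baseMap_lift r.L _ (Level₃.le_can_fst r s) r.hom, ← degFr_lift s.L _ (Level₃.le_can_snd r s) s.hom]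
  -- everything at the canonical triple level `(a, b, c)`
  unfold Rep.comp compAt
  generalize Level.lift r.L (Level₃.can r s).fst (Level₃.le_can_fst r s) r.hom = φ
  generalize Level.lift s.L (Level₃.can r s).snd (Level₃.le_can_snd r s) s.hom = ψ
  unfold Rep.div Rep.baseMap Rep.degFr
  dsimp only
  rw [Frobenioids.Perfection.map_mk, Frobenioids.Perfection.mk_pow, PreFrobenioid.div_comp, map_mul, map_pow,
    ← pull_comp, ← pull_comp, Category.assoc, Category.assoc, baseInvFrob_base_frob, Category.comp_id,
    show Y.idx * (r.L.b * s.L.a) = X.idx * (r.L.a * s.L.a) from (Level₃.can r s).eq₁.symm,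
    Frobenioids.Perfection.mk_mul_mk, ← mul_pow, Frobenioids.Perfection.mk_pow_mul]

variable (hF) in
/-- The operations of the perfection `C^pf` over the base `D`: `Base`, the divisor monoid `Φ^pf`, `Div`,
`deg_Fr` with the laws of Remark 1.1.1 — the pre-Frobenioid structure "`C^pf → F_{Φ^pf}`" of
Prop. 3.2 (i) in t3's operations form. [cite: MochizukiFrdI2008, Prop. 3.2 (i) p.58] -/
noncomputable def ops : PreFrobenioidData.{w} (Perfection hF) D where
  base :=
    { obj := fun X => baseObj F X.obj
      map := fun f => Hom.baseMap f
      map_id := fun X => baseMap_id X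
      map_comp := fun f g => baseMap_comp f g }
  Mon X := Frobenioids.Perfection (Φ.obj (op X))
  pull f := Frobenioids.Perfection.map (pull Φ f)
  pull_id X x := by
    rw [show pull Φ (𝟙 X) = MonoidHom.id _ from MonoidHom.ext fun y => pull_id Φ X y,
      Frobenioids.Perfection.map_id]
    rfl
  pull_comp β α x := by
    rw [show pull Φ (β ≫ α) = (pull Φ β).comp (pull Φ α) from MonoidHom.ext fun y => pull_comp Φ β α y,
      Frobenioids.Perfection.map_comp]
    rfl
  div f := Hom.div f
  degFr f := Hom.degFr f
  div_id X := div_id' X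
  div_comp ψ φ := div_comp' ψ φ
  degFr_id X := degFr_id' X
  degFr_comp ψ φ := degFr_comp' ψ φ

end Perfection

/-! ### The `PerfectionData` of a Frobenioid -/

/-- THE perfection datum of the Frobenioid `F : C → F_Φ`: the category `C^pf` of Def. 3.1 (iii), the
functor `C → C^pf`, the roots `(A, n)` and the operations of Prop. 3.2 (i), packaged in t3's interface
`PerfectionData` over the operations form `PreFrobenioidData.ofFunctor Φ F` of `F`.
[cite: MochizukiFrdI2008, Def. 3.1 (iii) p.57] -/
noncomputable def _root_.Literature.AlgebraicGeometry.Frobenioids.PreFrobenioidData.perfection :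
    PerfectionData (PreFrobenioidData.ofFunctor Φ F) where
  Pf := Perfection hF
  toPf := Perfection.toPf hF
  root := Perfection.root hF
  root_one _ := rfl
  root_surjective := Perfection.root_surjective
  ops := Perfection.ops hF

end PreFrobenioid

end Literature.AlgebraicGeometry.Frobenioids
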